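import Literature.MathematicalPhysics.QuantumLattice.ApproximatingHamiltonianProofs
import HarnessLib

/-!
# Local perturbations perturb locally, from decay of correlations in the UNPERTURBED Gibbs state: the quantum-belief-propagation covariance bound (Capel–Moscolari–Teufel–Wessel, Thm 14), finite-dimensional core

Capel–Moscolari–Teufel–Wessel (CMTW), *From decay of correlations to locality and stability of the
Gibbs state*, Commun. Math. Phys. 406 (2025) 43 = arXiv:2310.09182 [CapelEtAl2023], Theorem 14
("LPPL from correlations in the unperturbed state", p. 11): for a quantum lattice system on a
finite `Λ`, `H` self-adjoint, a perturbation `V` supported in `X`, Gibbs states `ρ_β(s)` of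
`H(s) = H + sV`, and the quantum-belief-propagation (QBP) decay function `ζ_QBP` of their Prop. 9,
every observable `B` supported in `Y` obeys
`|tr ρ_β(0) B - tr ρ_β(1) B| ≤ e^{2β‖V‖} ‖B‖ Cov_{ρ_β(0)}(X_r; Y) + 4β‖V‖‖B‖ ζ_QBP(X, r)`.

The PRINTED PROOF (p. 11) is three lines of finite-dimensional matrix algebra fed by two inputs:
(QBP) the perturbed state is a conjugate of the unperturbed one, `ρ(1) = η̃ ρ(0) η̃*`, by an operator
`η̃` with `‖η̃‖ ≤ e^{β‖V‖}` (CMTW Prop. 6 (b); Hastings, Phys. Rev. B 76 (2007) 201102);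
(LOC) `η̃` has a local approximation `η̃_ℓ ∈ 𝒜_{X_ℓ}` with `‖η̃_ℓ‖ ≤ ‖η̃‖` and
`‖η̃ - η̃_ℓ‖ ≤ β‖V‖e^{β‖V‖} ζ_QBP(X, ℓ)` (CMTW Prop. 9 (c), from Lieb–Robinson bounds), and for
`ℓ < dist(X, Y)` the local approximant COMMUTES with `B`.  Given these, the proof reads
(`ρ := ρ(0)`):

  `tr ρ(1)B - tr ρB = tr((η̃-η̃_ℓ)ρη̃*B) + tr(η̃_ℓρ(η̃*-η̃_ℓ*)B) + tr(ρ η̃_ℓ*η̃_ℓ B) - tr(ρB)`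
  (cyclicity of the trace and `[η̃_ℓ, B] = 0`); the first two terms are `≤ ‖η̃-η̃_ℓ‖(‖η̃‖+‖η̃_ℓ‖)‖B‖`;
  the case `B = 1` gives `|tr(ρ η̃_ℓ*η̃_ℓ) - 1| ≤ ‖η̃-η̃_ℓ‖(‖η̃‖+‖η̃_ℓ‖)`; hence
  `|tr ρ(1)B - tr ρB| ≤ 2‖η̃-η̃_ℓ‖(‖η̃‖+‖η̃_ℓ‖)‖B‖ + |Cov_ρ(η̃_ℓ*η̃_ℓ, B)|`
  `≤ 4β‖V‖e^{2β‖V‖} ζ_QBP(X,ℓ) ‖B‖ + e^{2β‖V‖}‖B‖ Cov_ρ(X_ℓ; Y)`.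

This file PROVES exactly this finite-dimensional core, on `Matrix n n ℂ` with the `ℓ²`-operator
norm and the tree's Gibbs-state vocabulary (`Matrix.gibbsState`, `Matrix.gibbsWeight`,
`Matrix.partitionFn` of `FinDimSpectrum.lean`), taking (QBP) and (LOC) as HYPOTHESES on given
matrices `η`, `ηl` — so that a consumer who has constructed the QBP intertwiner and its
Lieb–Robinson localisation (the model-specific, analytic part of CMTW §4 and §10) obtains Thm 14
by one application:

* §1 `trace_conj_mul_sub_trace_mul` — the three-term identity (cyclicity + `ηl * B = B * ηl`);
  `norm_trace_mul_mul_le_of_trace_one`, `norm_trace_densityMatrix_mul_le` — `|tr(X ρ Y)| ≤ ‖X‖‖Y‖`,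
  `|tr(ρ B)| ≤ ‖B‖` for a density matrix `ρ`
  (the tree's `norm_trace_mul_le_opNorm_mul_re_trace`, Koma–Tasaki's inequality ii)).
* §2 `norm_trace_conj_sub_trace_le` — the DENSITY-MATRIX form of the display in the proof of
  Thm 14: `ρ ≥ 0`, `tr ρ = 1`, `tr(ηρηᴴ) = 1`, `ηl B = B ηl` give
  `|tr(ηρηᴴB) - tr(ρB)| ≤ 2‖η-ηl‖(‖η‖+‖ηl‖)‖B‖ + |tr(ρ ηlᴴηl B) - tr(ρ ηlᴴηl) tr(ρB)|`.
* §3 `norm_gibbsState_sub_gibbsState_le_of_intertwiner` — the GIBBS-STATE form: for Hermitian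
  `H`, `K` and `η` intertwining the two states, `⟨A⟩_{β,K} = ⟨ηᴴ A η⟩_{β,H}` for all `A`
  (this is `ρ_K = η ρ_H ηᴴ`), the same bound with `Cov_{β,H}(ηlᴴηl, B)`.
* §4 `norm_gibbsState_sub_gibbsState_le_of_qbp_bounds` — the printed shape of Thm 14 with the
  constants of (QBP)/(LOC) as hypotheses (`‖η‖, ‖ηl‖ ≤ M`, `‖η - ηl‖ ≤ δ`, and decay of
  correlations of the UNPERTURBED state on the one pair `(ηlᴴηl, B)` with constant `c`):
  `|⟨B⟩_K - ⟨B⟩_H| ≤ M² ‖B‖ c + 4 δ M ‖B‖`; and `…_cmtw` — the literal specialisation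
  `M = e^{β‖K-H‖}`, `δ = β‖K-H‖e^{β‖K-H‖} ζ`:
  `|⟨B⟩_K - ⟨B⟩_H| ≤ e^{2β‖V‖}‖B‖ c + 4β‖V‖‖B‖ e^{2β‖V‖} ζ`, `V = K - H`.
  NOTE (faithfulness): the printed statement (5.1) carries the factor `e^{2β‖V‖}` on the
  covariance term only; the printed proof (last display on p. 11) produces it on BOTH terms, and
  that is what is proved here — never stronger than the source's proof.
* §5 `gibbsState_eq_div_mul_gibbsState_conj` / `exists_normalisedIntertwiner` — the normalisation
  step of CMTW Prop. 6 (b) from Prop. 6 (a): a WEIGHT-level intertwiner `e^{-βK} = η e^{-βH} ηᴴ`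
  yields the STATE-level one with `η̃ = (Z_H/Z_K)^{1/2} η`, and `(Z_H/Z_K)^{1/2} ≤ e^{β‖K-H‖/2}`
  by the free-energy Lipschitz bound of the tree (`abs_log_partitionFn_sub_log_partitionFn_le`),
  so `‖η‖ ≤ e^{β‖V‖/2}` (Prop. 6 (a), CMTW (10.4)) gives `‖η̃‖ ≤ e^{β‖V‖}` (Prop. 6 (b)).

Everything is PROVED (theorems only; no definition, no named fact).  What is NOT here: the
existence of the QBP intertwiner `η` (CMTW Prop. 6 (a): the ODE `d/ds e^{-βH(s)} =
-(β/2){e^{-βH(s)}, Φ_β^{H(s)}(V)}` and its ordered exponential) and its Lieb–Robinson localisation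
`ηl` (Prop. 9) — these are the hypotheses `hηK`, `hcomm`, `hM`, `hδ` below; the fermionic version
(CMTW Remark 18, p. 12, "with minor modifications") enters only through them (for even `ηl` far
from an even `B` the graded commutator is the commutator, so `hcomm` is the right hypothesis there
too).  Consumer: route `TcThermcert1`, line `gauge_qbp_far_seam` stub B
(`stub_farCutCurrent_of_clustering`), whose helper parts `Theorems/TcThermcert1QbpOrderedExponential`
(conjugation identity + stability of ordered exponentials) and `Theorems/TcThermcert1QbpGenerator`
(the weighted Heisenberg average `Φ_f`) build exactly the inputs taken as hypotheses here.

## References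

* Á. Capel, M. Moscolari, S. Teufel, T. Wessel, Commun. Math. Phys. 406 (2025) 43,
  arXiv:2310.09182: Thm 14 and its proof (p. 11), Prop. 6 (p. 8), Prop. 9 (pp. 8–9),
  Remark 18 (p. 12). [CapelEtAl2023]
* M. B. Hastings, *Quantum belief propagation: an algorithm for thermal quantum systems*,
  Phys. Rev. B 76 (2007) 201102(R), arXiv:0706.4094 (the intertwiner `η`).
* the tree: `TraceInequalitiesProofs` (`norm_trace_mul_le_opNorm_mul_re_trace`, Koma–Tasaki PRL 68
  (1992) 3248, ii)), `FinDimSpectrum` (Gibbs states), `ApproximatingHamiltonianProofs`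
  (`norm_gibbsState_le`, `abs_log_partitionFn_sub_log_partitionFn_le`).
-/

noncomputable section

open scoped Matrix.Norms.L2Operator ComplexOrder
open Matrix

namespace Literature.MathematicalPhysics.QuantumLattice

variable {n : Type*} [Fintype n] [DecidableEq n]

/-! ## §1 The three-term identity and the density-matrix Hölder bound -/

section Algebra

/-- **The three-term identity of CMTW's proof of Thm 14** (p. 11, first display): for any
`ρ η ηl B` with `ηl B = B ηl`,
`tr(ηρηᴴB) - tr(ρB) = tr((η-ηl)ρ(ηᴴB)) + tr(ηlρ((η-ηl)ᴴB)) + (tr(ρ(ηlᴴηl B)) - tr(ρB))`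
— pure algebra: `(η-ηl)ρηᴴB + ηlρ(η-ηl)ᴴB = ηρηᴴB - ηlρηlᴴB` and, by cyclicity of the trace and
the commutation hypothesis, `tr(ηl ρ ηlᴴ B) = tr(ρ ηlᴴ B ηl) = tr(ρ ηlᴴ ηl B)`.
[cite: CapelEtAl2023, Thm 14 (proof, first display)] -/
theorem trace_conj_mul_sub_trace_mul (ρ η ηl B : Matrix n n ℂ) (hcomm : ηl * B = B * ηl) :
    (η * ρ * ηᴴ * B).trace - (ρ * B).trace =
      ((η - ηl) * ρ * (ηᴴ * B)).trace + (ηl * ρ * ((η - ηl)ᴴ * B)).trace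
        + ((ρ * (ηlᴴ * ηl * B)).trace - (ρ * B).trace) := by
  -- cyclicity + commutation: `tr(ηl ρ ηlᴴ B) = tr(ρ ηlᴴ ηl B)`
  have hkey : (ηl * ρ * (ηlᴴ * B)).trace = (ρ * (ηlᴴ * ηl * B)).trace := by
    rw [Matrix.mul_assoc, trace_mul_comm, Matrix.mul_assoc, Matrix.mul_assoc, ← hcomm,
      Matrix.mul_assoc]
  -- the telescoping of the first two terms
  have halg : (η - ηl) * ρ * (ηᴴ * B) + ηl * ρ * ((η - ηl)ᴴ * B) =
      η * ρ * ηᴴ * B - ηl * ρ * (ηlᴴ * B) := by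
    rw [conjTranspose_sub]
    noncomm_ring
  have htr := congrArg Matrix.trace halg
  rw [trace_add, trace_sub] at htr
  rw [← hkey]
  linear_combination -htr

/-- **`|tr(X ρ Y)| ≤ ‖X‖ ‖Y‖` for a density matrix** `ρ ≥ 0`, `tr ρ = 1` (`ℓ²` operator norms):
cyclicity `tr(XρY) = tr(YX ρ)` and the tree's `|tr(O P)| ≤ ‖O‖ tr P` (Koma–Tasaki ii)).
[cite: KomaTasakiPRL1992, proof of eq. (10), inequality ii)] -/
theorem norm_trace_mul_mul_le_of_trace_one {ρ : Matrix n n ℂ} (hρ : ρ.PosSemidef)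
    (hρ1 : ρ.trace = 1) (X Y : Matrix n n ℂ) : ‖(X * ρ * Y).trace‖ ≤ ‖X‖ * ‖Y‖ := by
  have hcyc : (X * ρ * Y).trace = (Y * X * ρ).trace := by
    rw [trace_mul_comm, Matrix.mul_assoc]
  have h := norm_trace_mul_le_opNorm_mul_re_trace (Y * X) hρ
  rw [hρ1, Complex.one_re, mul_one] at h
  rw [hcyc]
  calc ‖(Y * X * ρ).trace‖ ≤ ‖Y * X‖ := h
    _ ≤ ‖Y‖ * ‖X‖ := norm_mul_le _ _
    _ = ‖X‖ * ‖Y‖ := mul_comm _ _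

/-- `|tr(ρ B)| ≤ ‖B‖` for a density matrix. [cite: KomaTasakiPRL1992, proof of eq. (10), ii)] -/
theorem norm_trace_densityMatrix_mul_le {ρ : Matrix n n ℂ} (hρ : ρ.PosSemidef) (hρ1 : ρ.trace = 1)
    (B : Matrix n n ℂ) : ‖(ρ * B).trace‖ ≤ ‖B‖ := by
  have h := norm_trace_mul_le_opNorm_mul_re_trace B hρ
  rw [hρ1, Complex.one_re, mul_one] at h
  rwa [trace_mul_comm] at h

end Algebra

/-! ## §2 The density-matrix form of the Thm 14 estimate -/

section DensityMatrix

/-- **CMTW Thm 14, density-matrix core** (the second display of the printed proof, p. 11): if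
`ρ ≥ 0`, `tr ρ = 1`, the conjugated matrix `η ρ ηᴴ` again has trace `1` (it is the perturbed
STATE, `ρ(1) = η̃ρ(0)η̃*`, CMTW Prop. 6 (b)), and the local approximant `ηl` commutes with the
observable `B` (disjoint supports), then
`|tr(ηρηᴴB) - tr(ρB)| ≤ 2‖η - ηl‖(‖η‖ + ‖ηl‖)‖B‖ + |tr(ρ ηlᴴηl B) - tr(ρ ηlᴴηl)·tr(ρB)|`
(the last term is the covariance `Cov_ρ(ηlᴴηl, B)` of the UNPERTURBED state).
[cite: CapelEtAl2023, Thm 14 (proof, second display)] -/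
theorem norm_trace_conj_sub_trace_le {ρ : Matrix n n ℂ} (hρ : ρ.PosSemidef) (hρ1 : ρ.trace = 1)
    {η : Matrix n n ℂ} (hη1 : (η * ρ * ηᴴ).trace = 1) (ηl B : Matrix n n ℂ)
    (hcomm : ηl * B = B * ηl) :
    ‖(η * ρ * ηᴴ * B).trace - (ρ * B).trace‖ ≤
      2 * (‖η - ηl‖ * (‖η‖ + ‖ηl‖)) * ‖B‖ +
        ‖(ρ * (ηlᴴ * ηl * B)).trace - (ρ * (ηlᴴ * ηl)).trace * (ρ * B).trace‖ := by
  -- the two "off-diagonal" terms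
  have hT1 : ‖((η - ηl) * ρ * (ηᴴ * B)).trace‖ ≤ ‖η - ηl‖ * (‖η‖ * ‖B‖) := by
    refine (norm_trace_mul_mul_le_of_trace_one hρ hρ1 _ _).trans ?_
    gcongr
    exact (norm_mul_le _ _).trans (by rw [l2_opNorm_conjTranspose])
  have hT2 : ‖(ηl * ρ * ((η - ηl)ᴴ * B)).trace‖ ≤ ‖ηl‖ * (‖η - ηl‖ * ‖B‖) := by
    refine (norm_trace_mul_mul_le_of_trace_one hρ hρ1 _ _).trans ?_
    gcongr
    exact (norm_mul_le _ _).trans (by rw [l2_opNorm_conjTranspose])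
  -- the case `B = 1`: `|tr(ρ ηlᴴ ηl) - 1| ≤ ‖η - ηl‖ (‖η‖ + ‖ηl‖)`
  have hN : ‖(ρ * (ηlᴴ * ηl)).trace - 1‖ ≤ ‖η - ηl‖ * ‖η‖ + ‖ηl‖ * ‖η - ηl‖ := by
    have hid := trace_conj_mul_sub_trace_mul ρ η ηl 1 (by rw [Matrix.mul_one, Matrix.one_mul])
    rw [Matrix.mul_one, Matrix.mul_one, Matrix.mul_one, Matrix.mul_one, Matrix.mul_one, hη1, hρ1,
      sub_self] at hid
    -- `0 = T1 + T2 + (N - 1)`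
    have hN' : (ρ * (ηlᴴ * ηl)).trace - 1 =
        -(((η - ηl) * ρ * ηᴴ).trace + (ηl * ρ * (η - ηl)ᴴ).trace) := by
      linear_combination -hid
    rw [hN', norm_neg]
    refine (norm_add_le _ _).trans (add_le_add ?_ ?_)
    · have h := norm_trace_mul_mul_le_of_trace_one hρ hρ1 (η - ηl) ηᴴ
      rwa [l2_opNorm_conjTranspose] at h
    · have h := norm_trace_mul_mul_le_of_trace_one hρ hρ1 ηl (η - ηl)ᴴ
      rwa [l2_opNorm_conjTranspose] at h
  have hB : ‖(ρ * B).trace‖ ≤ ‖B‖ := norm_trace_densityMatrix_mul_le hρ hρ1 B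
  -- assemble
  have hid := trace_conj_mul_sub_trace_mul ρ η ηl B hcomm
  have hsplit : (ρ * (ηlᴴ * ηl * B)).trace - (ρ * B).trace =
      ((ρ * (ηlᴴ * ηl * B)).trace - (ρ * (ηlᴴ * ηl)).trace * (ρ * B).trace) +
        ((ρ * (ηlᴴ * ηl)).trace - 1) * (ρ * B).trace := by ring
  rw [hid, hsplit]
  have hprod : ‖((ρ * (ηlᴴ * ηl)).trace - 1) * (ρ * B).trace‖ ≤
      (‖η - ηl‖ * ‖η‖ + ‖ηl‖ * ‖η - ηl‖) * ‖B‖ := by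
    rw [norm_mul]
    exact mul_le_mul hN hB (norm_nonneg _) (by positivity)
  calc ‖((η - ηl) * ρ * (ηᴴ * B)).trace + (ηl * ρ * ((η - ηl)ᴴ * B)).trace +
          ((ρ * (ηlᴴ * ηl * B)).trace - (ρ * (ηlᴴ * ηl)).trace * (ρ * B).trace +
            ((ρ * (ηlᴴ * ηl)).trace - 1) * (ρ * B).trace)‖
      ≤ ‖((η - ηl) * ρ * (ηᴴ * B)).trace‖ + ‖(ηl * ρ * ((η - ηl)ᴴ * B)).trace‖ +
          (‖(ρ * (ηlᴴ * ηl * B)).trace - (ρ * (ηlᴴ * ηl)).trace * (ρ * B).trace‖ +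
            ‖((ρ * (ηlᴴ * ηl)).trace - 1) * (ρ * B).trace‖) :=
        (norm_add_le _ _).trans (add_le_add (norm_add_le _ _) (norm_add_le _ _))
    _ ≤ ‖η - ηl‖ * (‖η‖ * ‖B‖) + ‖ηl‖ * (‖η - ηl‖ * ‖B‖) +
          (‖(ρ * (ηlᴴ * ηl * B)).trace - (ρ * (ηlᴴ * ηl)).trace * (ρ * B).trace‖ +
            (‖η - ηl‖ * ‖η‖ + ‖ηl‖ * ‖η - ηl‖) * ‖B‖) := by
        gcongr
    _ = 2 * (‖η - ηl‖ * (‖η‖ + ‖ηl‖)) * ‖B‖ +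
          ‖(ρ * (ηlᴴ * ηl * B)).trace - (ρ * (ηlᴴ * ηl)).trace * (ρ * B).trace‖ := by ring

end DensityMatrix

/-! ## §3 The Gibbs-state form -/

section GibbsState

variable {H K : Matrix n n ℂ}

/-- The Gibbs state of a Hermitian `H` IS a density matrix: `ρ_H = Z⁻¹ e^{-βH} ≥ 0`, `tr ρ_H = 1`,
`⟨A⟩_{β,H} = tr(ρ_H A)`. Bratteli–Robinson II §5.3.1. [folklore] -/
private theorem gibbsDensityMatrix_posSemidef_trace_apply (hH : H.IsHermitian) [Nonempty n] (β : ℝ) :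
    ((partitionFn β H)⁻¹ • gibbsWeight β H).PosSemidef ∧
      ((partitionFn β H)⁻¹ • gibbsWeight β H).trace = 1 ∧
        ∀ A, gibbsState β H A = ((partitionFn β H)⁻¹ • gibbsWeight β H * A).trace := by
  have hZre : 0 < (partitionFn β H).re := partitionFn_re_pos hH β
  have hZ : partitionFn β H = ((partitionFn β H).re : ℂ) := partitionFn_eq_re hH β
  have hinv : (partitionFn β H)⁻¹ = ((((partitionFn β H).re)⁻¹ : ℝ) : ℂ) := by
    rw [Complex.ofReal_inv, ← hZ]
  refine ⟨?_, ?_, ?_⟩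
  · rw [hinv]
    exact (posDef_gibbsWeight β hH).posSemidef.smul
      (Complex.zero_le_real.mpr (inv_nonneg.mpr hZre.le))
  · rw [trace_smul, smul_eq_mul]
    show (partitionFn β H)⁻¹ * partitionFn β H = 1
    exact inv_mul_cancel₀ (partitionFn_pos β hH).ne'
  · intro A
    rw [gibbsState_apply, smul_mul_assoc, trace_smul, smul_eq_mul]

/-- **CMTW Thm 14, Gibbs-state form.** Let `H`, `K` be Hermitian and let `η` intertwine the two
Gibbs states, `⟨A⟩_{β,K} = ⟨ηᴴ A η⟩_{β,H}` for every `A` (i.e. `ρ_K = η ρ_H ηᴴ` — the normalised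
QBP intertwiner `η̃(1)` of CMTW Prop. 6 (b) for `K = H + V`); let `ηl` commute with `B`.  Then
`|⟨B⟩_{β,K} - ⟨B⟩_{β,H}| ≤ 2‖η - ηl‖(‖η‖ + ‖ηl‖)‖B‖ + |Cov_{β,H}(ηlᴴηl, B)|`, where
`Cov_{β,H}(A, B) = ⟨A B⟩_{β,H} - ⟨A⟩_{β,H}⟨B⟩_{β,H}`.
[cite: CapelEtAl2023, Thm 14 (proof, second display)] -/
theorem norm_gibbsState_sub_gibbsState_le_of_intertwiner (hH : H.IsHermitian) (hK : K.IsHermitian)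
    [Nonempty n] (β : ℝ) {η : Matrix n n ℂ}
    (hηK : ∀ A, gibbsState β K A = gibbsState β H (ηᴴ * A * η)) (ηl B : Matrix n n ℂ)
    (hcomm : ηl * B = B * ηl) :
    ‖gibbsState β K B - gibbsState β H B‖ ≤
      2 * (‖η - ηl‖ * (‖η‖ + ‖ηl‖)) * ‖B‖ +
        ‖gibbsState β H (ηlᴴ * ηl * B) - gibbsState β H (ηlᴴ * ηl) * gibbsState β H B‖ := by
  obtain ⟨hρ, hρ1, hρA⟩ := gibbsDensityMatrix_posSemidef_trace_apply hH β
  set ρ := (partitionFn β H)⁻¹ • gibbsWeight β H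
  -- the perturbed state is the conjugate: `⟨A⟩_K = tr(η ρ ηᴴ A)`
  have hconj : ∀ A, gibbsState β K A = (η * ρ * ηᴴ * A).trace := by
    intro A
    rw [hηK, hρA, show ρ * (ηᴴ * A * η) = ρ * (ηᴴ * A) * η by simp only [Matrix.mul_assoc],
      trace_mul_comm, show η * (ρ * (ηᴴ * A)) = η * ρ * ηᴴ * A by simp only [Matrix.mul_assoc]]
  have hη1 : (η * ρ * ηᴴ).trace = 1 := by
    have h := hconj 1
    rw [Matrix.mul_one, gibbsState_one β K (partitionFn_pos β hK).ne'] at h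
    exact h.symm
  rw [hconj B, hρA B, hρA (ηlᴴ * ηl * B), hρA (ηlᴴ * ηl)]
  exact norm_trace_conj_sub_trace_le hρ hρ1 hη1 ηl B hcomm

/-! ## §4 The printed shape: constants from the QBP bounds -/

/-- **CMTW Thm 14 with the QBP constants as hypotheses.** In the situation of
`norm_gibbsState_sub_gibbsState_le_of_intertwiner`, if `‖η‖ ≤ M`, `‖ηl‖ ≤ M` (CMTW Prop. 6 (b),
Prop. 9 (c): `M = e^{β‖V‖}`), `‖η - ηl‖ ≤ δ` (Prop. 9 (c): `δ = β‖V‖e^{β‖V‖} ζ_QBP(X, ℓ)`) and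
the UNPERTURBED state has decay of correlations on the pair `(ηlᴴηl, B)` with constant `c`
(`|Cov_{β,H}(ηlᴴηl, B)| ≤ ‖ηlᴴηl‖ ‖B‖ c`, `c = Cov_{ρ_β(0)}(X_ℓ; Y)`), then
`|⟨B⟩_{β,K} - ⟨B⟩_{β,H}| ≤ M² ‖B‖ c + 4 δ M ‖B‖`.
[cite: CapelEtAl2023, Thm 14 (proof, last display)] -/
theorem norm_gibbsState_sub_gibbsState_le_of_qbp_bounds (hH : H.IsHermitian) (hK : K.IsHermitian)
    [Nonempty n] (β : ℝ) {η ηl B : Matrix n n ℂ}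
    (hηK : ∀ A, gibbsState β K A = gibbsState β H (ηᴴ * A * η)) (hcomm : ηl * B = B * ηl)
    {M δ c : ℝ} (hM : ‖η‖ ≤ M) (hMl : ‖ηl‖ ≤ M) (hδ : ‖η - ηl‖ ≤ δ) (hc : 0 ≤ c)
    (hcov : ‖gibbsState β H (ηlᴴ * ηl * B) - gibbsState β H (ηlᴴ * ηl) * gibbsState β H B‖ ≤
      ‖ηlᴴ * ηl‖ * ‖B‖ * c) :
    ‖gibbsState β K B - gibbsState β H B‖ ≤ M ^ 2 * ‖B‖ * c + 4 * δ * M * ‖B‖ := by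
  have h := norm_gibbsState_sub_gibbsState_le_of_intertwiner hH hK β hηK ηl B hcomm
  have hM0 : 0 ≤ M := (norm_nonneg _).trans hM
  have hδ0 : 0 ≤ δ := (norm_nonneg _).trans hδ
  have hll : ‖ηlᴴ * ηl‖ ≤ M * M := by
    rw [l2_opNorm_conjTranspose_mul_self]
    exact mul_le_mul hMl hMl (norm_nonneg _) hM0
  have h1 : ‖ηlᴴ * ηl‖ * ‖B‖ * c ≤ M ^ 2 * ‖B‖ * c := by
    rw [sq]; gcongr
  have h2 : ‖η - ηl‖ * (‖η‖ + ‖ηl‖) ≤ δ * (M + M) :=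
    mul_le_mul hδ (add_le_add hM hMl) (by positivity) hδ0
  have h3 : 2 * (‖η - ηl‖ * (‖η‖ + ‖ηl‖)) * ‖B‖ ≤ 2 * (δ * (M + M)) * ‖B‖ := by gcongr
  linarith

/-- **CMTW Thm 14 as printed in its proof** (`V = K - H`, both terms carrying `e^{2β‖V‖}`):
with `‖η‖ ≤ e^{β‖V‖}`, `‖ηl‖ ≤ ‖η‖`, `‖η - ηl‖ ≤ β‖V‖e^{β‖V‖} ζ` (CMTW Prop. 6 (b), Prop. 9 (c),
`ζ = ζ_QBP(X, ℓ)`) and decay of correlations `c = Cov_{ρ_β(0)}(X_ℓ; Y)` of the unperturbed state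
on the pair `(ηlᴴηl, B)`:
`|⟨B⟩_{β,H+V} - ⟨B⟩_{β,H}| ≤ e^{2β‖V‖} ‖B‖ c + 4β‖V‖‖B‖ e^{2β‖V‖} ζ`.
(The printed STATEMENT, eq. (5.1), omits `e^{2β‖V‖}` on the `ζ` term; the printed PROOF, last
display of p. 11, yields exactly the present form, which is what is proved.)
[cite: CapelEtAl2023, Thm 14] -/
theorem norm_gibbsState_sub_gibbsState_le_cmtw (hH : H.IsHermitian) (hK : K.IsHermitian)
    [Nonempty n] {β : ℝ} {η ηl B : Matrix n n ℂ}
    (hηK : ∀ A, gibbsState β K A = gibbsState β H (ηᴴ * A * η)) (hcomm : ηl * B = B * ηl)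
    {ζ c : ℝ} (hc : 0 ≤ c) (hM : ‖η‖ ≤ Real.exp (β * ‖K - H‖)) (hMl : ‖ηl‖ ≤ ‖η‖)
    (hδ : ‖η - ηl‖ ≤ β * ‖K - H‖ * Real.exp (β * ‖K - H‖) * ζ)
    (hcov : ‖gibbsState β H (ηlᴴ * ηl * B) - gibbsState β H (ηlᴴ * ηl) * gibbsState β H B‖ ≤
      ‖ηlᴴ * ηl‖ * ‖B‖ * c) :
    ‖gibbsState β K B - gibbsState β H B‖ ≤
      Real.exp (2 * β * ‖K - H‖) * ‖B‖ * c +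
        4 * β * ‖K - H‖ * ‖B‖ * Real.exp (2 * β * ‖K - H‖) * ζ := by
  have h := norm_gibbsState_sub_gibbsState_le_of_qbp_bounds hH hK β hηK hcomm hM (hMl.trans hM) hδ
    hc hcov
  have hsq : Real.exp (β * ‖K - H‖) ^ 2 = Real.exp (2 * β * ‖K - H‖) := by
    rw [sq, ← Real.exp_add]; ring_nf
  have h4 : 4 * (β * ‖K - H‖ * Real.exp (β * ‖K - H‖) * ζ) * Real.exp (β * ‖K - H‖) * ‖B‖ =
      4 * β * ‖K - H‖ * ‖B‖ * Real.exp (2 * β * ‖K - H‖) * ζ := by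
    rw [← hsq]; ring
  rw [hsq, h4] at h
  exact h

/-! ## §5 Normalisation: from a weight-level intertwiner to the state-level one (CMTW Prop. 6 (b) from (a)) -/

/-- If `e^{-βK} = η e^{-βH} ηᴴ` (the QBP intertwiner of the EXPONENTIALS, CMTW Prop. 6 (a),
eq. (10.3)), then `⟨A⟩_{β,K} = (Z_H/Z_K) ⟨ηᴴ A η⟩_{β,H}`. [cite: CapelEtAl2023, Prop. 6] -/
theorem gibbsState_eq_div_mul_gibbsState_conj (hH : H.IsHermitian) (hK : K.IsHermitian)
    [Nonempty n] (β : ℝ) {η : Matrix n n ℂ} (hW : gibbsWeight β K = η * gibbsWeight β H * ηᴴ)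
    (A : Matrix n n ℂ) :
    gibbsState β K A = partitionFn β H / partitionFn β K * gibbsState β H (ηᴴ * A * η) := by
  have hZH : partitionFn β H ≠ 0 := (partitionFn_pos β hH).ne'
  have hZK : partitionFn β K ≠ 0 := (partitionFn_pos β hK).ne'
  have hcyc : (η * gibbsWeight β H * ηᴴ * A).trace = (gibbsWeight β H * (ηᴴ * A * η)).trace := by
    rw [Matrix.mul_assoc, Matrix.mul_assoc, trace_mul_comm, Matrix.mul_assoc]
  rw [gibbsState_apply, gibbsState_apply, hW, hcyc, div_eq_mul_inv]
  field_simp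

/-- `Z_H / Z_K ≤ e^{β‖K - H‖}` for Hermitian `H`, `K` and `β ≥ 0` (the free-energy Lipschitz
bound `|log Z_H - log Z_K| ≤ β‖H - K‖`). [folklore] -/
private theorem partitionFn_div_le_exp (hH : H.IsHermitian) (hK : K.IsHermitian) [Nonempty n] {β : ℝ}
    (hβ : 0 ≤ β) : (partitionFn β H).re / (partitionFn β K).re ≤ Real.exp (β * ‖K - H‖) := by
  have hZH : 0 < (partitionFn β H).re := partitionFn_re_pos hH β
  have hZK : 0 < (partitionFn β K).re := partitionFn_re_pos hK β
  have h := (le_abs_self _).trans (abs_log_partitionFn_sub_log_partitionFn_le hH hK hβ)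
  rw [norm_sub_rev] at h
  have h' : Real.log ((partitionFn β H).re / (partitionFn β K).re) ≤ β * ‖K - H‖ := by
    rwa [Real.log_div hZH.ne' hZK.ne']
  calc (partitionFn β H).re / (partitionFn β K).re
      = Real.exp (Real.log ((partitionFn β H).re / (partitionFn β K).re)) :=
        (Real.exp_log (div_pos hZH hZK)).symm
    _ ≤ Real.exp (β * ‖K - H‖) := Real.exp_le_exp.mpr h'

/-- **CMTW Prop. 6 (b) from Prop. 6 (a), finite-dimensional bookkeeping.** If
`e^{-βK} = η e^{-βH} ηᴴ`, then the RESCALED intertwiner `η̃ = (Z_H/Z_K)^{1/2} η` conjugates the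
STATES, `⟨A⟩_{β,K} = ⟨η̃ᴴ A η̃⟩_{β,H}` for all `A`, with `0 ≤ (Z_H/Z_K)^{1/2} ≤ e^{β‖K-H‖/2}`
(`β ≥ 0`); rescaling is by a nonnegative real scalar, so norms scale (`‖η̃‖ = s‖η‖`,
`‖η̃ - s ηl‖ = s‖η - ηl‖`) and commutation with `B` is preserved.  With CMTW (10.4)
`‖η‖ ≤ e^{β‖V‖/2}` this gives `‖η̃‖ ≤ e^{β‖V‖}`. [cite: CapelEtAl2023, Prop. 6] -/
theorem exists_normalisedIntertwiner (hH : H.IsHermitian) (hK : K.IsHermitian) [Nonempty n]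
    {β : ℝ} (hβ : 0 ≤ β) {η : Matrix n n ℂ} (hW : gibbsWeight β K = η * gibbsWeight β H * ηᴴ)
    (ηl : Matrix n n ℂ) :
    ∃ s : ℝ, 0 ≤ s ∧ s ≤ Real.exp (β * ‖K - H‖ / 2) ∧
      (∀ A, gibbsState β K A = gibbsState β H (((s : ℂ) • η)ᴴ * A * ((s : ℂ) • η))) ∧
      ‖(s : ℂ) • η‖ = s * ‖η‖ ∧ ‖(s : ℂ) • ηl‖ = s * ‖ηl‖ ∧
      ‖(s : ℂ) • η - (s : ℂ) • ηl‖ = s * ‖η - ηl‖ ∧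
      ∀ B, ηl * B = B * ηl → ((s : ℂ) • ηl) * B = B * ((s : ℂ) • ηl) := by
  have hZH : 0 < (partitionFn β H).re := partitionFn_re_pos hH β
  have hZK : 0 < (partitionFn β K).re := partitionFn_re_pos hK β
  set q : ℝ := (partitionFn β H).re / (partitionFn β K).re with hq
  have hq0 : 0 ≤ q := (div_pos hZH hZK).le
  set s : ℝ := Real.sqrt q with hs
  have hs0 : 0 ≤ s := Real.sqrt_nonneg q
  have hss : s * s = q := Real.mul_self_sqrt hq0
  have hnorm : ∀ X : Matrix n n ℂ, ‖(s : ℂ) • X‖ = s * ‖X‖ := fun X => by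
    rw [norm_smul, Complex.norm_real, Real.norm_of_nonneg hs0]
  refine ⟨s, hs0, ?_, ?_, hnorm η, hnorm ηl, by rw [← smul_sub, hnorm], ?_⟩
  · -- `s ≤ e^{β‖K-H‖/2}` from `q ≤ e^{β‖K-H‖}`
    rw [hs, Real.sqrt_le_iff]
    refine ⟨(Real.exp_pos _).le, ?_⟩
    rw [sq, ← Real.exp_add, add_halves]
    exact partitionFn_div_le_exp hH hK hβ
  · intro A
    have hqC : ((s : ℂ)) * (s : ℂ) = partitionFn β H / partitionFn β K := by
      rw [← Complex.ofReal_mul, hss, hq, Complex.ofReal_div, ← partitionFn_eq_re hH β,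
        ← partitionFn_eq_re hK β]
    rw [conjTranspose_smul, Complex.star_def, Complex.conj_ofReal, smul_mul_assoc, smul_mul_assoc,
      mul_smul_comm, map_smul, map_smul, smul_eq_mul, smul_eq_mul, ← mul_assoc, hqC]
    exact gibbsState_eq_div_mul_gibbsState_conj hH hK β hW A
  · intro B hB
    rw [smul_mul_assoc, mul_smul_comm, hB]

end GibbsState

end Literature.MathematicalPhysics.QuantumLattice
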